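import Summits.CriticalPhenomena.PercolationContinuityZ3.Theorems.PercAnnulusCrossingSlabThm31OfOne
import Literature.Probability.Percolation.SlabRSWTheorem314Case3
import HarnessLib

/-!
# NTW 2017, Theorem 3.1 at `p_c(S_k)` from the gluing step (H316) of Case 3 of Theorem 3.14

Composition of `NewmanTassionWu2017_thm31_of_one` (Thm 3.1 ⇐ Case 3 of Thm 3.14, all other inputs —
(H38), (H39), (H310), (H317), Case 2, the exploration of Case 3 — discharged in the tree) with p2's reduction
`NTW17.thm314_hCase3_of` (Case 3 ⇐ its gluing step (H316): Lemma 3.16 with the topology of `γ ∪ γ'`, NTW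
(3.47)–(3.52)).  What remains for `NewmanTassionWu2017_thm31_holds` is exactly (H316) at `p_c(S_k)` for every
`k ≥ 1` and one `ρ₂`.

* `boxCrossingProperty_slabCritical_of_h316`, **`NewmanTassionWu2017_thm31_of_h316`**.
-/

noncomputable section

namespace Summit.CriticalPhenomena.PercolationContinuityZ3.Theorems.Crossing

open MeasureTheory
open Literature.Probability.Percolation Literature.Probability.LatticeModels
open Literature.Probability.Percolation.NTW17

/-- **NTW's Theorem 3.1 at `p_c(S_k)` from (H316)** — the gluing step of Case 3 of Theorem 3.14 in the reflected frame
of `case2Setup n` (`S' = [0,7n]×[0,8n-1] ⊆ R' = [0,14n]×[0,13n-1]`): for every `x > 0` there are `y > 0`, `n₃` with: for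
`n ≥ n₃` and every admissible lattice configuration `ω`, `x ≤ P[C ⟷^{R' ∖ 𝒞(ω)} 𝖡]` implies `y ≤ f(14n, 13n)`.
[cite: NewmanTassionWu2017, Theorem 3.1 (§3.7) with Theorem 3.14 Case 3 ((3.47)–(3.52)) and Lemma 3.16] -/
theorem boxCrossingProperty_slabCritical_of_h316 (k : ℕ) (hk : 1 ≤ k) {ρ₂ : ℕ} (hρ₂ : 2 ≤ ρ₂)
    (h316 : ∀ x : ℝ, 0 < x → ∃ y : ℝ, 0 < y ∧ ∃ n₃ : ℕ, ∀ n : ℕ, n₃ ≤ n → ∀ hn : 1 ≤ n,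
      ∀ ω : BondConfig (slab 3 k), ω ⊆ (slabGraph 3 k).edgeSet →
      ω ∈ (case2Setup n hn).Q.evAB k → ω ∈ slabConn k (case2Setup n hn).R {z | z.2 = 0} (case2Setup n hn).C →
      ω ∉ (case2Setup n hn).Q.evCA k → ω ∉ (case2Setup n hn).Q.evNear k ρ₂ →
      x ≤ (bondPercolation (slabGraph 3 k) (criticalProbIOf (slabGraph 3 k) (slabOrigin 3 k))).real
        ((case2Setup n hn).Q.evOff k {z | z.2 = 0} ((case2Setup n hn).Q.explored k ρ₂ ω)) →
      y ≤ (bondPercolation (slabGraph 3 k) (criticalProbIOf (slabGraph 3 k) (slabOrigin 3 k))).real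
        (slabConn k (boxR 0 (14 * n) 0 (13 * n)) {z | z.1 = 0} {z | z.1 = 14 * n})) :
    BoxCrossingProperty k (criticalProbIOf (slabGraph 3 k) (slabOrigin 3 k)) :=
  boxCrossingProperty_slabCritical_of_one k hk hρ₂ (thm314_hCase3_of _ h316)

/-- **`NewmanTassionWu2017_thm31` from (H316) for every `k ≥ 1`** (one `ρ₂ ≥ 2` for all thicknesses).
[cite: NewmanTassionWu2017, Theorem 3.1 and §3.7, with Theorem 3.14 Case 3 and Lemma 3.16] -/
theorem NewmanTassionWu2017_thm31_of_h316 {ρ₂ : ℕ} (hρ₂ : 2 ≤ ρ₂)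
    (h316 : ∀ k : ℕ, 1 ≤ k → ∀ x : ℝ, 0 < x → ∃ y : ℝ, 0 < y ∧ ∃ n₃ : ℕ, ∀ n : ℕ, n₃ ≤ n → ∀ hn : 1 ≤ n,
      ∀ ω : BondConfig (slab 3 k), ω ⊆ (slabGraph 3 k).edgeSet →
      ω ∈ (case2Setup n hn).Q.evAB k → ω ∈ slabConn k (case2Setup n hn).R {z | z.2 = 0} (case2Setup n hn).C →
      ω ∉ (case2Setup n hn).Q.evCA k → ω ∉ (case2Setup n hn).Q.evNear k ρ₂ →
      x ≤ (bondPercolation (slabGraph 3 k) (criticalProbIOf (slabGraph 3 k) (slabOrigin 3 k))).real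
        ((case2Setup n hn).Q.evOff k {z | z.2 = 0} ((case2Setup n hn).Q.explored k ρ₂ ω)) →
      y ≤ (bondPercolation (slabGraph 3 k) (criticalProbIOf (slabGraph 3 k) (slabOrigin 3 k))).real
        (slabConn k (boxR 0 (14 * n) 0 (13 * n)) {z | z.1 = 0} {z | z.1 = 14 * n})) :
    NewmanTassionWu2017_thm31 :=
  fun k hk => boxCrossingProperty_slabCritical_of_h316 k hk hρ₂ (h316 k hk)

end Summit.CriticalPhenomena.PercolationContinuityZ3.Theorems.Crossing

end
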